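import Literature.NumberTheory.GaloisRepresentations.CliffordTwistOfRestriction
import HarnessLib

/-!
# A representation isomorphic to a non-trivial twist of itself has reducible restriction

Topic `NumberTheory/GaloisRepresentations`; namespace `Literature.NumberTheory.GaloisRepresentations`.
Theorems only: **no definition and no named fact is introduced**.

Let `f : H →ₜ* G` be a continuous homomorphism of topological groups, `A` an algebraically closed
topological field, `ρ : G →ₜ* GL_n(A)` a framed continuous representation and `χ : G →ₜ* Aˣ` a
continuous character which is TRIVIAL on `f(H)` but NOT trivial.  If `ρ` is isomorphic to its twist
`ρ ⊗ χ` (`P ρ P⁻¹ = ρ ⊗ χ` for some `P ∈ GL_n(A)`), then the restriction `ρ ∘ f` is REDUCIBLE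
(`FramedRep.not_isIrreducible_comp_of_conj_eq_twist`).

Proof (by contradiction, Schur).  Suppose `ρ ∘ f` irreducible.  Evaluating `P ρ P⁻¹ = ρ ⊗ χ` at
`f h` (where `χ = 1`) shows that `P` commutes with every `ρ (f h)`, so `P` is a scalar matrix by
Schur's lemma (`FramedRep.exists_eq_scalar_of_forall_commute`); scalars being central, `P ρ(g) P⁻¹ =
ρ(g)` for EVERY `g ∈ G`, whence `ρ(g) = χ(g) · ρ(g)` and, cancelling the unit `ρ(g)`, `χ(g) · 1 = 1`
in `GL_n(A)` with `n > 0` (`FramedRep.IsIrreducible.rank_pos`); reading off a diagonal entry,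
`χ(g) = 1` for all `g`, contradicting `χ ≠ 1`.

For an extension of fields `M/F` and `f = absGaloisRestrict F M : Γ_M →ₜ* Γ_F` this is the
Galois-side shadow of the easy half of the cuspidality criterion for cyclic base change
(Arthur–Clozel 1989, Ch. 3 Thm. 4.2: for `M/F` cyclic of prime degree and `π` cuspidal on
`GL_n(𝔸_F)`, `BC_{M/F}(π)` is cuspidal iff `π ≇ π ⊗ η` for the characters `η ≠ 1` of
`Gal(M/F)`): a Galois representation `ρ` of `Γ_F` with `ρ ≅ ρ ⊗ χ` for a character `χ ≠ 1` of
`Γ_F` killing `Γ_M` has REDUCIBLE restriction to `Γ_M`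
(`FramedGaloisRep.not_isIrreducible_restrictField_of_conj_eq_twist`).  (The converse direction —
an irreducible `ρ` with reducible restriction to a normal subgroup of prime index is induced, hence
twist-stable — is Clifford's theorem proper and is not treated here.)

## Main results

* `FramedRep.not_isIrreducible_comp_of_conj_eq_twist` — the abstract statement along any
  continuous homomorphism `f : H →ₜ* G`.
* `FramedGaloisRep.not_isIrreducible_restrictField_of_conj_eq_twist` — the Galois form along
  `absGaloisRestrict F M`.

## References

* A. H. Clifford, *Representations induced in an invariant subgroup*, Ann. of Math. 38 (1937),
  533–550, §§2–3. [Clifford1937]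
* J. Arthur, L. Clozel, *Simple algebras, base change, and the advanced theory of the trace formula*,
  Ann. of Math. Stud. 120 (1989), Ch. 3 Thm. 4.2. [ArthurClozelAMS120]
-/

noncomputable section

namespace Literature.NumberTheory.GaloisRepresentations

open Field

universe u u' v

section Abstract

variable {G : Type u} {H : Type u'} [Group G] [TopologicalSpace G] [Group H] [TopologicalSpace H]
  {A : Type v} [Field A] [TopologicalSpace A] [IsTopologicalRing A] {n : ℕ}

namespace FramedRep

/-- **A framed representation isomorphic to a non-trivial twist of itself by a character trivial on
`f(H)` has reducible restriction along `f`.**  Let `f : H →ₜ* G` be a continuous homomorphism,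
`ρ : G →ₜ* GL_n(A)` (`A` an algebraically closed topological field), and `χ : G →ₜ* Aˣ` a continuous
character with `χ ∘ f = 1` and `χ ≠ 1`.  If `P ρ P⁻¹ = ρ ⊗ χ` for some `P ∈ GL_n(A)`, then `ρ ∘ f`
is NOT irreducible: otherwise `P`, which commutes with `ρ(f(H))`, is scalar by Schur, so
`ρ = ρ ⊗ χ` on the nose and `χ = 1`. [cite: Clifford1937, §§2–3] -/
theorem not_isIrreducible_comp_of_conj_eq_twist [IsAlgClosed A] (f : H →ₜ* G)
    (ρ : FramedRep G A n) (χ : G →ₜ* Aˣ) (hχ : ∀ h : H, χ (f h) = 1) (hχ1 : χ ≠ 1)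
    (h : ∃ P : GL (Fin n) A, FramedRep.conj P ρ = ρ.twist χ) :
    ¬ FramedRep.IsIrreducible (ρ.comp f) := by
  intro hirr
  obtain ⟨P, hP⟩ := h
  -- `P ρ(g) P⁻¹ = χ(g) · ρ(g)` for every `g`
  have hPg : ∀ g : G, P * ρ g * P⁻¹ = scalar A n (χ g) * ρ g := fun g => by
    have := congrArg (fun σ : FramedRep G A n => σ g) hP
    simpa only [conj_apply, twist_apply] using this
  -- on `f(H)` the character is trivial, so `P` commutes with `ρ (f h)`
  have hcomm : ∀ h' : H, P * ρ (f h') = ρ (f h') * P := fun h' => by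
    have h1 := hPg (f h')
    rw [hχ h', map_one, one_mul] at h1
    exact mul_inv_eq_iff_eq_mul.1 h1
  -- Schur: `P` is a scalar matrix
  obtain ⟨c, hc⟩ := exists_eq_scalar_of_forall_commute hirr (P : Matrix (Fin n) (Fin n) A)
    fun h' => by
      show (P : Matrix (Fin n) (Fin n) A) * ((ρ (f h') : GL (Fin n) A) : Matrix (Fin n) (Fin n) A) =
        ((ρ (f h') : GL (Fin n) A) : Matrix (Fin n) (Fin n) A) * (P : Matrix (Fin n) (Fin n) A)
      rw [← Units.val_mul, ← Units.val_mul, hcomm h']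
  -- hence `P` is central and `P ρ(g) P⁻¹ = ρ(g)` for ALL `g`
  have hcentral : ∀ g : G, P * ρ g = ρ g * P := fun g => by
    ext1
    rw [Units.val_mul, Units.val_mul, hc]
    exact Algebra.commutes c ((ρ g : GL (Fin n) A) : Matrix (Fin n) (Fin n) A)
  -- so `χ(g) · 1 = 1` in `GL_n(A)`
  have hscalar : ∀ g : G, scalar A n (χ g) = 1 := fun g => by
    have h1 := hPg g
    rw [hcentral g, mul_inv_cancel_right] at h1
    -- h1 : ρ g = scalar A n (χ g) * ρ g
    exact mul_eq_right.1 h1.symm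
  -- `n > 0`, so a diagonal entry gives `χ(g) = 1`
  have hn : 0 < n := hirr.rank_pos
  let i₀ : Fin n := ⟨0, hn⟩
  apply hχ1
  refine ContinuousMonoidHom.ext fun g => ?_
  rw [ContinuousMonoidHom.coe_one, Pi.one_apply]
  ext
  have h2 := congrArg (fun Q : GL (Fin n) A => (Q : Matrix (Fin n) (Fin n) A) i₀ i₀) (hscalar g)
  simp only [coe_scalar_apply, algebraMap_matrix_apply_same, Units.val_one,
    Matrix.one_apply_eq] at h2
  rw [h2, Units.val_one]

end FramedRep

end Abstract

section Galois

/-- **A Galois representation isomorphic to a non-trivial twist of itself by a character killing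
`Γ_M` has reducible restriction to `Γ_M`.**  Let `M/F` be an extension of fields,
`ρ : Γ_F → GL_n(A)` (`A` algebraically closed) a framed continuous Galois representation and
`χ : Γ_F →ₜ* Aˣ` a continuous character, trivial on (the image under `absGaloisRestrict F M` of)
`Γ_M` but `χ ≠ 1`, with `P ρ P⁻¹ = ρ ⊗ χ` for some `P`.  Then `ρ|_{Γ_M}` is reducible.  This is the
Galois shadow of the easy half of the cuspidality criterion for cyclic base change: `π ≅ π ⊗ η`
with `η ≠ 1` forces `BC_{M/F}(π)` non-cuspidal. [cite: ArthurClozelAMS120, Ch. 3 Thm. 4.2] -/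
theorem FramedGaloisRep.not_isIrreducible_restrictField_of_conj_eq_twist
    {F M : Type} [Field F] [Field M] [Algebra F M] {A : Type v} [Field A] [TopologicalSpace A]
    [IsTopologicalRing A] [IsAlgClosed A] {n : ℕ} (ρ : FramedGaloisRep F A n)
    (χ : absoluteGaloisGroup F →ₜ* Aˣ)
    (hχ : ∀ σ : absoluteGaloisGroup M, χ (absGaloisRestrict F M σ) = 1) (hχ1 : χ ≠ 1)
    (h : ∃ P : GL (Fin n) A, FramedRep.conj P ρ = ρ.twist χ) :
    ¬ (ρ.restrictField M).IsIrreducible :=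
  FramedRep.not_isIrreducible_comp_of_conj_eq_twist (absGaloisRestrict F M) ρ χ hχ hχ1 h

end Galois

end Literature.NumberTheory.GaloisRepresentations

end
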